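import Mathlib
import Summits.ResolutionOfSingularities.ResolutionOfSingularities.Theorems.ShadowGameWinR.Negative.MirrorR
import Summits.ResolutionOfSingularities.ResolutionOfSingularities.Theorems.ShadowGameWinR.Negative.CertCore
import Summits.ResolutionOfSingularities.ResolutionOfSingularities.Theorems.ShadowGameShadowGameWinRStubOrders

/-!
# `ShadowGameWinR` (crux stmt-ResolutionOfSingularities-18182, route `ShadowGame`), negative side —
# part 3d: a position of B's family is never terminal′

`not_terminalR_posSt : ¬ TerminalR p (fn (posSt p a e b U E))` for units `U, E`: clause 1 (`f ≠ 0`) and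
clause 2a (no monomial of degree `≤ 1`) from `stub_orders`; clause 2b (unique minimal exponent ⇒
`f = u^A · v'`, `v'` a unit) and clause 3 (`f = w^A · v + g^p`, `w` a formal system of parameters — whose
linear parts are invertible: `isUnit_det_of_span_eq`) are both instances of `no_monomial_decomposition`.
Lead prover-line-stmt-ResolutionOfSingularities-18182-0, 2026-08-17.
-/

noncomputable section

set_option linter.dupNamespace false

namespace Summit.ResolutionOfSingularities.ResolutionOfSingularities.Theorems.ShadowGameWinR.Negative

open Summit.ResolutionOfSingularities.ResolutionOfSingularities.Theorems.ShadowGameWin.Negative (clean)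
open MvPowerSeries

variable {κ : Type} [Field κ]

variable (p : ℕ) [Fact p.Prime] [CharP κ p]

/-- The linear coefficient of `c · w` when `w` has no constant term. [folklore] -/
theorem coeff_single_mul_of_constantCoeff_eq_zero (c w : MvPowerSeries (Fin 3) κ)
    (hw : MvPowerSeries.constantCoeff w = 0) (l : Fin 3) :
    MvPowerSeries.coeff (Finsupp.single l 1) (c * w) =
      MvPowerSeries.constantCoeff c * MvPowerSeries.coeff (Finsupp.single l 1) w := by
  classical
  rw [MvPowerSeries.coeff_mul, Finsupp.antidiagonal_single, Finset.sum_map, Finset.Nat.antidiagonal_succ,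
    Finset.sum_cons, Finset.Nat.antidiagonal_zero, Finset.map_singleton, Finset.sum_singleton]
  simp [hw]

/-- A formal regular system of parameters has an invertible matrix of linear coefficients. [folklore] -/
theorem isUnit_det_of_span_eq (w : Fin 3 → MvPowerSeries (Fin 3) κ)
    (hspan : Ideal.span (Set.range w) = IsLocalRing.maximalIdeal (MvPowerSeries (Fin 3) κ)) :
    (∀ j, MvPowerSeries.constantCoeff (w j) = 0) ∧
    IsUnit (Matrix.det (Matrix.of fun i j => MvPowerSeries.coeff (Finsupp.single i 1) (w j))) := by
  classical
  have hw0 : ∀ j, MvPowerSeries.constantCoeff (w j) = 0 := by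
    intro j
    have hj : w j ∈ IsLocalRing.maximalIdeal (MvPowerSeries (Fin 3) κ) := by
      rw [← hspan]; exact Ideal.subset_span ⟨j, rfl⟩
    rw [IsLocalRing.mem_maximalIdeal, mem_nonunits_iff, MvPowerSeries.isUnit_iff_constantCoeff] at hj
    by_contra hne
    exact hj (isUnit_iff_ne_zero.mpr hne)
  refine ⟨hw0, ?_⟩
  have hX : ∀ i, ∃ c : Fin 3 → MvPowerSeries (Fin 3) κ, ∑ j, c j * w j = X i := by
    intro i
    have hi : (X i : MvPowerSeries (Fin 3) κ) ∈ Ideal.span (Set.range w) := by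
      rw [hspan, IsLocalRing.mem_maximalIdeal, mem_nonunits_iff, MvPowerSeries.isUnit_iff_constantCoeff]
      simp
    exact Ideal.mem_span_range_iff_exists_fun.mp hi
  choose c hc using hX
  set L : Matrix (Fin 3) (Fin 3) κ := Matrix.of fun i j => MvPowerSeries.coeff (Finsupp.single i 1) (w j)
  set N : Matrix (Fin 3) (Fin 3) κ := Matrix.of fun j i => MvPowerSeries.constantCoeff (c i j)
  have hLN : L * N = 1 := by
    ext l i
    rw [Matrix.mul_apply, Matrix.one_apply]
    have := congrArg (MvPowerSeries.coeff (Finsupp.single l 1)) (hc i)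
    rw [map_sum, MvPowerSeries.coeff_X] at this
    simp only [coeff_single_mul_of_constantCoeff_eq_zero _ _ (hw0 _)] at this
    simp only [L, N, Matrix.of_apply]
    rw [show (∑ j, MvPowerSeries.coeff (Finsupp.single l 1) (w j) * MvPowerSeries.constantCoeff (c i j)) =
      ∑ j, MvPowerSeries.constantCoeff (c i j) * MvPowerSeries.coeff (Finsupp.single l 1) (w j) from
      Finset.sum_congr rfl fun j _ => mul_comm _ _, this]
    by_cases h : l = i
    · subst h; simp
    · rw [if_neg, if_neg h]
      intro heq
      exact h ((Finsupp.single_left_injective one_ne_zero) heq)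
  exact IsUnit.of_mul_eq_one _ (by rw [← Matrix.det_mul, hLN, Matrix.det_one])

/-- The product `∏_j X_j ^ A j` is the monomial `u^A`. [folklore] -/
theorem prod_X_pow_eq_monomial (A : Fin 3 → ℕ) :
    (Finset.prod Finset.univ fun j => (X j : MvPowerSeries (Fin 3) κ) ^ A j) =
      MvPowerSeries.monomial (Finsupp.equivFunOnFinite.symm A) 1 := by
  have h3 : (Finset.prod Finset.univ fun j => (X j : MvPowerSeries (Fin 3) κ) ^ A j) =
      X 0 ^ A 0 * X 1 ^ A 1 * X 2 ^ A 2 := Fin.prod_univ_three _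
  have hsum : Finsupp.single (0 : Fin 3) (A 0) + Finsupp.single 1 (A 1) + Finsupp.single 2 (A 2) =
      Finsupp.equivFunOnFinite.symm A := by
    ext j
    fin_cases j <;> simp
  rw [h3, MvPowerSeries.X_pow_eq, MvPowerSeries.X_pow_eq, MvPowerSeries.X_pow_eq,
    MvPowerSeries.monomial_mul_monomial, MvPowerSeries.monomial_mul_monomial, mul_one, mul_one, hsum]

/-- **A position is never terminal′.** [folklore] -/
theorem not_terminalR_posSt (a e b : ℕ) (U E : MvPowerSeries (Fin 3) κ) (hU : IsUnit U) (hE : IsUnit E) :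
    ¬ TerminalR p (fn (posSt p a e b U E)) := by
  classical
  have hord := stub_orders p κ a e b U E hU hE
  simp only [] at hord
  obtain ⟨-, -, -, -, -, -, -, hcl, hf0, hlow⟩ := hord
  change ∀ d : Fin 3 →₀ ℕ, (∀ j, p ∣ d j) → MvPowerSeries.coeff d (posSt p a e b U E) = 0 at hcl
  change posSt p a e b U E ≠ 0 at hf0
  change ∀ d : Fin 3 →₀ ℕ, Finsupp.degree d ≤ 1 → MvPowerSeries.coeff d (posSt p a e b U E) = 0 at hlow
  set f : MvPowerSeries (Fin 3) κ := posSt p a e b U E with hfdef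
  have hclean : clean p (fn f) = fn f := by
    funext A
    unfold clean
    split_ifs with h
    · exact (hcl (Finsupp.equivFunOnFinite.symm A) (fun j => by simpa using h j)).symm
    · rfl
  intro hT
  rcases hT with h1 | ⟨A, hA, h2⟩ | ⟨w, A, v, g, hspan, ⟨k, hk⟩, hv, hcoef⟩
  · apply hf0
    ext d
    have := h1 ⇑d
    rw [hclean, fn_apply_coe] at this
    rw [this]; simp
  · have hnd : ∃ k, ¬ p ∣ A k := by
      by_contra! hall
      apply hA; unfold clean; rw [if_pos hall]
    rw [hclean] at hA
    rcases h2 with hdeg | hmin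
    · apply hA
      show MvPowerSeries.coeff (Finsupp.equivFunOnFinite.symm A) f = 0
      apply hlow
      rw [Finsupp.degree_eq_sum]
      simpa using hdeg
    · obtain ⟨k, hk⟩ := hnd
      set dA : Fin 3 →₀ ℕ := Finsupp.equivFunOnFinite.symm A with hdA
      have hAfn : fn f A = MvPowerSeries.coeff dA f := rfl
      have hsupp : ∀ d : Fin 3 →₀ ℕ, MvPowerSeries.coeff d f ≠ 0 → dA ≤ d := by
        intro d hd j
        have hcl' : clean p (fn f) ⇑d ≠ 0 := by rw [hclean, fn_apply_coe]; exact hd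
        have := hmin ⇑d hcl' j
        simpa [hdA] using this
      let v' : MvPowerSeries (Fin 3) κ := fun d => MvPowerSeries.coeff (d + dA) f
      have hv'c : ∀ d, MvPowerSeries.coeff d v' = MvPowerSeries.coeff (d + dA) f := fun d => rfl
      have hv' : IsUnit v' := by
        rw [MvPowerSeries.isUnit_iff_constantCoeff, ← MvPowerSeries.coeff_zero_eq_constantCoeff_apply, hv'c,
          zero_add, ← hAfn]
        exact isUnit_iff_ne_zero.mpr hA
      have hfv : f = (Finset.prod Finset.univ fun j => (X j : MvPowerSeries (Fin 3) κ) ^ A j) * v' + 0 ^ p := by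
        rw [zero_pow (Nat.Prime.ne_zero Fact.out), add_zero, prod_X_pow_eq_monomial]
        ext d
        rw [MvPowerSeries.coeff_monomial_mul]
        split_ifs with h
        · rw [one_mul, hv'c, tsub_add_cancel_of_le h]
        · by_contra hne
          exact h (hsupp d hne)
      refine no_monomial_decomposition p a e b U E hU (fun j => X j) (fun j => by simp) ?_ A k hk v' 0 hv' hfv
      have : (Matrix.of fun i j => MvPowerSeries.coeff (Finsupp.single i 1) ((X j : MvPowerSeries (Fin 3) κ))) = 1 := by
        ext i j
        rw [Matrix.of_apply, Matrix.one_apply, MvPowerSeries.coeff_X]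
        by_cases h : i = j
        · subst h; simp
        · rw [if_neg, if_neg h]
          intro heq; exact h ((Finsupp.single_left_injective one_ne_zero) heq)
      rw [this, Matrix.det_one]; exact isUnit_one
  · obtain ⟨hw0, hdet⟩ := isUnit_det_of_span_eq w hspan
    have hfeq : f = (Finset.prod Finset.univ fun j => w j ^ A j) * v + g ^ p := by
      ext d
      have := hcoef d
      rw [hclean, fn_apply_coe] at this
      exact this
    exact no_monomial_decomposition p a e b U E hU w hw0 hdet A k hk v g hv hfeq

end Summit.ResolutionOfSingularities.ResolutionOfSingularities.Theorems.ShadowGameWinR.Negative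

end
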